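import Summits.ResolutionOfSingularities.ResolutionOfSingularities.Theorems.CompanionAlgebra
import HarnessLib

/-!
# CompanionHasse — decomp-res node «CompanionCut» (lens-4 g26, critic row 154), tree file 2/7 of the node

Content VERBATIM from the decomp-res lens-4 g26 node `HOME/decomp-res-lens-4/g26/CompanionCut.lean` (pin 12d9bf52, 1
262 l, 56 declarations;
HOME = run/shared/lean/pub/decomp-res) = ONE NEW PART §66–§70, NO CARRY, on top of the landed
`Theorems/HeightCutCells` (g25) +
`Theorems/MaxContactCutKangarooCut` (h71 wiring) + `Theorems/ContactFreeIsPPower` (lens-6).  Critic: CRITIC-LEDGER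
row 154 (CLEARED
2026-08-30T23:45:15Z, DECIDED +1 (ii*): THE COMPANION LAW at every weight — Hasse descent of a `p^e`-power form to
a weight-`p^e`
companion with LINEAR weak contact, Giraud transport with a typed jump dichotomy in every weight, the deciding implication
«eventually companion-jump-free ⇒ 31571's class» and the EXACT re-location of the g25 residual
`NoWildKangarooOffDoublePointTowers`
to the companion-recurrent towers `NoWildCompanionKangarooTowers`; inhabitants both sides).  Landing orders INBOX
:519 (lens-4 g26
landing note, split per NEXT-g27 §4) and :528 (critic): `--kind proof --supports
stmt-ResolutionOfSingularities-28338`, namespace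
`…Theorems.HugValuationCut`.  Landed by decomp-res writer g8 CONE-AWARE in seven files: `CompanionAlgebra` ·
`CompanionHasse` ·
`CompanionPresentation` (§66–§67) · `CompanionTransport` (§68) · `CompanionTowers` (§69) ·
`CompanionCutCells` (§70 cone-free cells and
hypothesis-free re-locations) are OUTSIDE the Theses cone (importable by the route file); the five §70 corollaries GIVEN 31571
`MaxContactCut.NoContactHuggingTowers` BY NAME are the in-cone wiring file `MaxContactCutCompanionCut`.  Aside
bookkeeping (row 154):
ONE successor aside on the lens-4 column, `NoWildCompanionKangarooTowers` (home `CompanionCutCells`) SUPERSEDING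
`HCNoWildKangarooOffDoublePointTowers` (g25, route rev 43); exactness `noWildKangarooOffDoublePointTowers_iff_companion (h71)`;
the decided cell `NoWildCompanionJumpFreeTowers` (⟸ 31571, `noWildCompanionJumpFreeTowers_of_item`) is not filed.

§66, second third: THE MAIN COMPUTATION (L0) `exists_hasse_apply_companion` — HASSE DESCENT: for `f ≡
Q(u^{p^e})` with a unit
coefficient at a monomial with an exponent not divisible by `p`, the Hasse derivative `Δ_q f`, `q := p^e·(α₀ − ε_i)`,
is a `p^e`-power
form of degree `p^e` computing its order.  PROVED, 0 sorry.  Imports `CompanionAlgebra`.  Cone-free.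

[WRITER NOTE (decomp-res writer g8): section split only (400-line cap; §66 `section CompanionAlgebra` is re-opened
with the same
`variable` lines in `CompanionHasse` / `CompanionPresentation`); namespace, universes, section variables and every
declaration exactly
as in the lens (global `set_option` dropped; the lens's in-cone import `MaxContactCutKangarooCut` and the `open
…Theses` line live only
in the wiring file `MaxContactCutCompanionCut`).]

(Sources: Giraud1975 Thm 5.2; EncinasVillamayor2000 Thm 4.9; BravoGarciaEscamillaEncinasVillamayor2012 Lemma 4.6;
KawanoueMatsuki2010; Kawanoue arXiv:math/0607009; CossartPiltant2008 §2; Cossart2011 ex. III.2; Hauser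
arXiv:0811.4151; FruehbisKrueger arXiv:1007.2203 §3; BenitoVillamayor arXiv:1004.1803; Lucas 1878.)
-/

noncomputable section

open CategoryTheory AlgebraicGeometry IsLocalRing
open Literature.AlgebraicGeometry.Resolution
open Summit.ResolutionOfSingularities.ResolutionOfSingularities.Theorems
open WeakOrderReduction ForcedTowerClasses DivergentTowerClasses MonomialTowerClasses
open HugDimensionClasses HugDimensionKernels SurfaceShadowClasses SurfaceShadowKernels
open NearPointCut (SingularClass)
open AbsoluteContactClasses (IsAbsContactAt SepResidueAt diffIdeal_restrict_le stalkMap_comp_toStalk_eq_stalkHom)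
open scoped BigOperators

namespace Summit.ResolutionOfSingularities.ResolutionOfSingularities.Theorems.HugValuationCut

section CompanionAlgebra

variable {k R : Type*} [CommRing k] [CommRing R] [Algebra k R]

variable {ι : Type*} [Fintype ι]

/-- **THE `p^e`-COMPANION CONTACT (KERNEL, PROVED) — the one computation of g26.**  Let `(R, 𝔪)` be local of
characteristic `p` with a Hasse–Schmidt system `Δ` of level `n` on the regular system of parameters `u`, `n = p^e
· m`, and let
`f ≡ Q(u^{p^e}) (mod 𝔪^{n+1})` with `Q` a form of degree `m` having a UNIT coefficient at a multi-index `α₀`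
with an exponent
`α₀ i ≢ 0 (mod p)`.  Then for `q := p^e · (α₀ − e_i)` (`|q| = n − p^e`) the Hasse derivative `Δ_q f` is a WEAK
CONTACT ELEMENT OF
WEIGHT `p^e`:  `Δ_q f ∈ ⟨h^{p^e} : h ∈ 𝔪⟩ + 𝔪^{p^e+1}` and `Δ_q f ∉ 𝔪^{p^e+1}`.  (Every term of
the Leibniz expansion other
than `c_α · Δ_q(u^{p^e α})` drops into `𝔪^{p^e+1}` by ORDER LOWERING alone; the main terms are `p^e`-th
powers; the non-vanishing
is certified by `Δ_{p^e e_i}`, whose value mod `𝔪` is `c_{α₀} · C(p^e α₀ i, p^e (α₀ i − 1)) =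
c_{α₀} · α₀ i` — LUCAS.)
(Sources: Giraud1975 (weight-`p` companions); EncinasVillamayor2000, Thm. 4.9; BGEV2012, Lemma 4.6; KawanoueMatsuki2010;
CossartPiltant2008 §2; folklore.) -/
theorem exists_hasse_apply_companion [IsLocalRing R] [DecidableEq ι] {u : ι → R}
    (hu : Ideal.span (Set.range u) = maximalIdeal R) {n : ℕ}
    {Δ : (ι →₀ ℕ) → (R →ₗ[k] R)} (h0 : ∀ b, Δ 0 b = b)
    (hL : ∀ q : ι →₀ ℕ, q.degree ≤ n →
      ∀ f g : R, Δ q (f * g) = ∑ c ∈ Finset.HasAntidiagonal.antidiagonal q, Δ c.1 f * Δ c.2 g)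
    (hV : ∀ q β : ι →₀ ℕ, q.degree ≤ n →
      Δ q (∏ i, u i ^ β i) = ((∏ i ∈ q.support, (β i).choose (q i) : ℕ) : R) * ∏ i, u i ^ (β - q) i)
    (hD : ∀ (d : ℕ) (q : ι →₀ ℕ), q.degree ≤ d → d ≤ n → IsDiffOpLE k d (Δ q))
    (p : ℕ) [Fact p.Prime] [CharP R p] {e m : ℕ} (hnm : n = p ^ e * m) {f : R}
    (Q : MvPolynomial ι R) (hQ : Q.IsHomogeneous m)
    (hfQ : f - MvPolynomial.eval (fun i => u i ^ (p ^ e)) Q ∈ maximalIdeal R ^ (n + 1))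
    {α₀ : ι →₀ ℕ} (hα₀ : α₀ ∈ Q.support) (hc : Q.coeff α₀ ∉ maximalIdeal R) {i : ι} (hi : ¬ p ∣ α₀ i) :
    ∃ q : ι →₀ ℕ, q.degree + p ^ e = n ∧
      Δ q f ∈ Ideal.span ((fun h : R => h ^ (p ^ e)) '' ↑(maximalIdeal R)) ⊔ maximalIdeal R ^ (p ^ e + 1) ∧
      Δ q f ∉ maximalIdeal R ^ (p ^ e + 1) := by
  classical
  have hwp : ∀ a b : ℕ, (((p ^ e * a).choose (p ^ e * b) : ℕ) : R) = ((a.choose b : ℕ) : R) :=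
    natCast_choose_pow_mul p e
  have hw1 : 1 ≤ p ^ e := Nat.one_le_pow _ _ (Fact.out : p.Prime).pos
  generalize hw : p ^ e = w at hwp hw1 hnm hfQ ⊢
  have hw0 : w ≠ 0 := by omega
  have hum : ∀ i, u i ∈ maximalIdeal R := fun i => hu ▸ Ideal.subset_span ⟨i, rfl⟩
  have hmon : ∀ β : ι →₀ ℕ, (∏ i, u i ^ β i) ∈ maximalIdeal R ^ β.degree := fun β => prod_pow_mem_pow_degree hum β
  have hdeg : ∀ d ∈ Q.support, Finsupp.degree d = m := fun d hd => by
    have := hQ (MvPolynomial.mem_support_iff.mp hd)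
    rw [Finsupp.degree_eq_weight_one]
    exact this
  have hwdeg : ∀ β : ι →₀ ℕ, (w • β).degree = w * β.degree := fun β => by rw [map_nsmul, smul_eq_mul]
  have hvpow : ∀ β : ι →₀ ℕ, (∏ l, u l ^ β l) ^ w = ∏ l, u l ^ (w • β) l := fun β => by
    rw [← Finset.prod_pow]
    exact Finset.prod_congr rfl fun l _ => by rw [← pow_mul, Finsupp.smul_apply, smul_eq_mul, mul_comm]
  -- `e_i`, `γ = α₀ − e_i`, `q = w • γ`
  have hα₀i : 1 ≤ α₀ i := Nat.one_le_iff_ne_zero.mpr fun h => hi (h ▸ dvd_zero p)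
  set ei : ι →₀ ℕ := Finsupp.single i 1 with hei
  have heα : ei ≤ α₀ := by rw [hei, Finsupp.single_le_iff]; exact hα₀i
  have heideg : ei.degree = 1 := by rw [hei, Finsupp.degree_single]
  set γ : ι →₀ ℕ := α₀ - ei with hγ
  have hγe : γ + ei = α₀ := tsub_add_cancel_of_le heα
  have hα₀γ : α₀ - γ = ei := by rw [← hγe, add_tsub_cancel_left]
  have hγdeg : γ.degree + 1 = m := by
    have := congrArg Finsupp.degree hγe
    rw [map_add, heideg, hdeg α₀ hα₀] at this
    exact this
  have hα₀i' : α₀ i = γ i + 1 := by rw [← hγe, Finsupp.add_apply, hei, Finsupp.single_eq_same]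
  have hα₀j : ∀ j, j ≠ i → α₀ j = γ j := fun j hj => by
    rw [← hγe, Finsupp.add_apply, hei, Finsupp.single_apply, if_neg fun h => hj h.symm, add_zero]
  set q : ι →₀ ℕ := w • γ with hq
  have hql : ∀ l, q l = w * γ l := fun l => by rw [hq, Finsupp.smul_apply, smul_eq_mul]
  have hqdeg : q.degree + w = n := by rw [hq, hwdeg, hnm, ← hγdeg]; ring
  have hqn : q.degree ≤ n := by omega
  have hwn : w ≤ n := by rw [hnm]; exact Nat.le_mul_of_pos_right w (by omega)
  -- degree of the quotient monomials
  have hD1 : ∀ d ∈ Q.support, 1 ≤ (d - γ).degree := fun d hd => by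
    have := degree_le_degree_tsub_add d γ
    rw [hdeg d hd] at this
    omega
  have hsubq : ∀ d : ι →₀ ℕ, w • d - q = w • (d - γ) := fun d => by
    ext l
    simp only [hq, Finsupp.tsub_apply, Finsupp.smul_apply, smul_eq_mul, mul_tsub]
  -- the presentation of `g := Q(u^w)` and the expansion of `Δ_q g`
  have hg : MvPolynomial.eval (fun i => u i ^ w) Q = ∑ d ∈ Q.support, Q.coeff d * ∏ l, u l ^ (w • d) l := by
    rw [MvPolynomial.eval_eq']
    refine Finset.sum_congr rfl fun d _ => ?_
    congr 1
    exact Finset.prod_congr rfl fun l _ => by rw [← pow_mul, Finsupp.smul_apply, smul_eq_mul]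
  have hexp : Δ q (MvPolynomial.eval (fun i => u i ^ w) Q) = ∑ d ∈ Q.support,
      ∑ ab ∈ Finset.HasAntidiagonal.antidiagonal q, Δ ab.1 (Q.coeff d) * Δ ab.2 (∏ l, u l ^ (w • d) l) := by
    rw [hg, map_sum]
    exact Finset.sum_congr rfl fun d _ => hL q hqn _ _
  have h0q : ((0 : ι →₀ ℕ), q) ∈ Finset.HasAntidiagonal.antidiagonal q :=
    Finset.HasAntidiagonal.mem_antidiagonal.mpr (zero_add q)
  -- the binomial unit of the main term
  set C : (ι →₀ ℕ) → R := fun d => ((∏ l ∈ q.support, ((w • d) l).choose (q l) : ℕ) : R) with hC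
  have hT0 : ∀ d : ι →₀ ℕ, Δ (0 : ι →₀ ℕ) (Q.coeff d) * Δ q (∏ l, u l ^ (w • d) l) =
      (Q.coeff d * C d) * ∏ l, u l ^ (w • (d - γ)) l := fun d => by
    rw [h0, hV q (w • d) hqn, hsubq, mul_assoc]
  -- ORDER LOWERING: every other term of `Δ_q g` lies in `𝔪^{w+1}`
  have herr : ∀ d ∈ Q.support, ∀ ab ∈ Finset.HasAntidiagonal.antidiagonal q, ab ≠ ((0 : ι →₀ ℕ), q) →
      Δ ab.1 (Q.coeff d) * Δ ab.2 (∏ l, u l ^ (w • d) l) ∈ maximalIdeal R ^ (w + 1) := by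
    rintro d hd ⟨a, b⟩ hab hne
    have hab' : a + b = q := Finset.HasAntidiagonal.mem_antidiagonal.mp hab
    have ha : a ≠ 0 := by
      rintro rfl
      rw [zero_add] at hab'
      exact hne (by rw [hab'])
    have hadeg : 1 ≤ a.degree := Nat.one_le_iff_ne_zero.mpr fun h => ha ((Finsupp.degree_eq_zero_iff a).mp h)
    have hbdeg : a.degree + b.degree = q.degree := by
      have := congrArg Finsupp.degree hab'
      rw [map_add] at this
      exact this
    have hwd : (w • d).degree = n := by rw [hwdeg, hdeg d hd, hnm]
    have hmb : Δ b (∏ l, u l ^ (w • d) l) ∈ maximalIdeal R ^ (w + 1) := by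
      have h := (hD b.degree b le_rfl (by omega)).apply_mem_pow_sub (maximalIdeal R) n (hwd ▸ hmon (w • d))
      exact Ideal.pow_le_pow_right (by omega) h
    exact Ideal.mul_mem_left _ _ hmb
  -- hence `Δ_q f ≡ Mn := Σ_d c_d · C_d · u^{w (d − γ)}  (mod 𝔪^{w+1})`
  set Mn : R := ∑ d ∈ Q.support, Δ (0 : ι →₀ ℕ) (Q.coeff d) * Δ q (∏ l, u l ^ (w • d) l) with hMn
  have hkey : Δ q f - Mn ∈ maximalIdeal R ^ (w + 1) := by
    have h1 : Δ q f - Δ q (MvPolynomial.eval (fun i => u i ^ w) Q) ∈ maximalIdeal R ^ (w + 1) := by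
      rw [← map_sub]
      have := (hD q.degree q le_rfl hqn).apply_mem_pow_sub (maximalIdeal R) (n + 1) hfQ
      rwa [show n + 1 - q.degree = w + 1 by omega] at this
    have h2 : Δ q (MvPolynomial.eval (fun i => u i ^ w) Q) - Mn ∈ maximalIdeal R ^ (w + 1) := by
      have : Δ q (MvPolynomial.eval (fun i => u i ^ w) Q) - Mn = ∑ d ∈ Q.support,
          ∑ ab ∈ (Finset.HasAntidiagonal.antidiagonal q).erase ((0 : ι →₀ ℕ), q),
            Δ ab.1 (Q.coeff d) * Δ ab.2 (∏ l, u l ^ (w • d) l) := by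
        rw [hexp, hMn, ← Finset.sum_sub_distrib]
        exact Finset.sum_congr rfl fun d _ => by rw [← Finset.add_sum_erase _ _ h0q, add_sub_cancel_left]
      rw [this]
      exact Ideal.sum_mem _ fun d hd => Ideal.sum_mem _ fun ab hab =>
        herr d hd ab (Finset.mem_of_mem_erase hab) (Finset.ne_of_mem_erase hab)
    have := add_mem h1 h2
    rwa [sub_add_sub_cancel] at this
  -- (b) the main terms are `w`-th powers of elements of `𝔪`
  have hMnspan : Mn ∈ Ideal.span ((fun h : R => h ^ w) '' ↑(maximalIdeal R)) := by
    refine Ideal.sum_mem _ fun d hd => ?_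
    rw [hT0 d, ← hvpow (d - γ)]
    refine Ideal.mul_mem_left _ _ (Ideal.subset_span ⟨_, ?_, rfl⟩)
    exact Ideal.pow_le_self (by have := hD1 d hd; omega) (hmon (d - γ))
  refine ⟨q, hqdeg, ?_, fun hm2 => ?_⟩
  · have : Δ q f = Mn + (Δ q f - Mn) := by ring
    rw [this]
    exact Submodule.add_mem_sup hMnspan hkey
  -- (c) the certificate `Δ_ε`, `ε = w e_i`
  have hMn2 : Mn ∈ maximalIdeal R ^ (w + 1) := by
    have := sub_mem hm2 hkey
    rwa [sub_sub_cancel] at this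
  set ε : ι →₀ ℕ := Finsupp.single i w with hε
  have hεdeg : ε.degree = w := by rw [hε, Finsupp.degree_single]
  have hεsupp : ε.support = {i} := by rw [hε, Finsupp.support_single i hw0]
  have hεi : ε i = w := by rw [hε, Finsupp.single_eq_same]
  have hwei : w • ei = ε := by rw [hei, hε, Finsupp.smul_single, smul_eq_mul, mul_one]
  have hΔε : IsDiffOpLE k w (Δ ε) := hD w ε hεdeg.le hwn
  have hy : Δ ε Mn ∈ maximalIdeal R := by
    have := hΔε.apply_mem_pow_sub (maximalIdeal R) (w + 1) hMn2
    rwa [Nat.add_sub_cancel_left, pow_one] at this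
  have hexp2 : Δ ε Mn = ∑ d ∈ Q.support, ∑ ab ∈ Finset.HasAntidiagonal.antidiagonal ε,
      Δ ab.1 (Q.coeff d * C d) * Δ ab.2 (∏ l, u l ^ (w • (d - γ)) l) := by
    rw [hMn, map_sum]
    exact Finset.sum_congr rfl fun d _ => by rw [hT0 d, hL ε (by omega)]
  have h0ε : ((0 : ι →₀ ℕ), ε) ∈ Finset.HasAntidiagonal.antidiagonal ε :=
    Finset.HasAntidiagonal.mem_antidiagonal.mpr (zero_add ε)
  -- every term except `(α₀, (0, ε))` lies in `𝔪`
  have hterm : ∀ d ∈ Q.support, ∀ ab ∈ Finset.HasAntidiagonal.antidiagonal ε, (d, ab) ≠ (α₀, ((0 : ι →₀ ℕ), ε)) →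
      Δ ab.1 (Q.coeff d * C d) * Δ ab.2 (∏ l, u l ^ (w • (d - γ)) l) ∈ maximalIdeal R := by
    rintro d hd ⟨a, b⟩ hab hne
    have hab' : a + b = ε := Finset.HasAntidiagonal.mem_antidiagonal.mp hab
    by_cases ha : a = 0
    · subst ha
      rw [zero_add] at hab'
      subst hab'
      have hdne : d ≠ α₀ := fun h => hne (by rw [h])
      dsimp only
      rw [h0, hV ε (w • (d - γ)) (by omega), hεsupp, Finset.prod_singleton, hεi, Finsupp.smul_apply, smul_eq_mul]
      by_cases h1 : (d - γ) i = 0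
      · rw [h1, mul_zero, Nat.choose_eq_zero_of_lt (by omega), Nat.cast_zero, zero_mul, mul_zero]
        exact zero_mem _
      · by_cases hγd : γ ≤ d
        · exfalso
          apply hdne
          have hdeg' : (d - γ).degree = 1 := by
            have := congrArg Finsupp.degree (tsub_add_cancel_of_le hγd)
            rw [map_add, hdeg d hd] at this
            omega
          have hed : ei = d - γ := eq_of_le_of_degree_eq'
            (by rw [hei, Finsupp.single_le_iff]; exact Nat.one_le_iff_ne_zero.mpr h1) (by rw [heideg, hdeg'])
          rw [← tsub_add_cancel_of_le hγd, ← hed, add_comm, hγe]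
        · obtain ⟨l, hl⟩ : ∃ l, d l < γ l := by
            by_contra hcon
            push Not at hcon
            exact hγd (Finsupp.le_def.mpr hcon)
          have hlq : l ∈ q.support := Finsupp.mem_support_iff.mpr (by
            rw [hql]; exact Nat.mul_ne_zero hw0 (by omega))
          have hC0 : C d = 0 := by
            simp only [hC]
            rw [Finset.prod_eq_zero hlq, Nat.cast_zero]
            rw [Finsupp.smul_apply, smul_eq_mul, hql]
            exact Nat.choose_eq_zero_of_lt (Nat.mul_lt_mul_of_pos_left hl (by omega))
          rw [hC0, mul_zero, zero_mul]
          exact zero_mem _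
    · have hadeg : 1 ≤ a.degree := Nat.one_le_iff_ne_zero.mpr fun h => ha ((Finsupp.degree_eq_zero_iff a).mp h)
      have hbdeg : a.degree + b.degree = w := by
        have := congrArg Finsupp.degree hab'
        rw [map_add, hεdeg] at this
        exact this
      have hX : w ≤ (w • (d - γ)).degree := by
        rw [hwdeg]
        exact Nat.le_mul_of_pos_right w (hD1 d hd)
      have hmb : Δ b (∏ l, u l ^ (w • (d - γ)) l) ∈ maximalIdeal R := by
        have h := (hD b.degree b le_rfl (by omega)).apply_mem_pow_sub (maximalIdeal R) ((w • (d - γ)).degree)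
          (hmon (w • (d - γ)))
        exact Ideal.pow_le_self (by omega) h
      exact Ideal.mul_mem_left _ _ hmb
  -- the term `(α₀, (0, ε))` equals `c_{α₀} · C α₀`
  have hmain : Δ (0 : ι →₀ ℕ) (Q.coeff α₀ * C α₀) * Δ ε (∏ l, u l ^ (w • (α₀ - γ)) l) = Q.coeff α₀ * C α₀ := by
    rw [h0, hα₀γ, hwei, hV ε ε (by omega), tsub_self, hεsupp, Finset.prod_singleton, hεi, Nat.choose_self,
      Nat.cast_one, one_mul]
    simp
  have hsum : Δ ε Mn - Q.coeff α₀ * C α₀ ∈ maximalIdeal R := by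
    rw [hexp2, ← Finset.add_sum_erase _ _ hα₀, ← Finset.add_sum_erase _ _ h0ε, hmain]
    have hA : ∑ ab ∈ (Finset.HasAntidiagonal.antidiagonal ε).erase (0, ε),
        Δ ab.1 (Q.coeff α₀ * C α₀) * Δ ab.2 (∏ l, u l ^ (w • (α₀ - γ)) l) ∈ maximalIdeal R :=
      Ideal.sum_mem _ fun ab hab =>
        hterm α₀ hα₀ ab (Finset.mem_of_mem_erase hab) fun h => (Finset.ne_of_mem_erase hab) (Prod.ext_iff.mp h).2
    have hB : ∑ d ∈ Q.support.erase α₀, ∑ ab ∈ Finset.HasAntidiagonal.antidiagonal ε,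
        Δ ab.1 (Q.coeff d * C d) * Δ ab.2 (∏ l, u l ^ (w • (d - γ)) l) ∈ maximalIdeal R :=
      Ideal.sum_mem _ fun d hd => Ideal.sum_mem _ fun ab hab =>
        hterm d (Finset.mem_of_mem_erase hd) ab hab fun h => (Finset.ne_of_mem_erase hd) (Prod.ext_iff.mp h).1
    have : Q.coeff α₀ * C α₀ +
        ∑ ab ∈ (Finset.HasAntidiagonal.antidiagonal ε).erase (0, ε),
          Δ ab.1 (Q.coeff α₀ * C α₀) * Δ ab.2 (∏ l, u l ^ (w • (α₀ - γ)) l) +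
        ∑ d ∈ Q.support.erase α₀, ∑ ab ∈ Finset.HasAntidiagonal.antidiagonal ε,
          Δ ab.1 (Q.coeff d * C d) * Δ ab.2 (∏ l, u l ^ (w • (d - γ)) l) - Q.coeff α₀ * C α₀ =
        ∑ ab ∈ (Finset.HasAntidiagonal.antidiagonal ε).erase (0, ε),
          Δ ab.1 (Q.coeff α₀ * C α₀) * Δ ab.2 (∏ l, u l ^ (w • (α₀ - γ)) l) +
        ∑ d ∈ Q.support.erase α₀, ∑ ab ∈ Finset.HasAntidiagonal.antidiagonal ε,
          Δ ab.1 (Q.coeff d * C d) * Δ ab.2 (∏ l, u l ^ (w • (d - γ)) l) := by ring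
    rw [this]
    exact add_mem hA hB
  -- LUCAS: `C α₀` is a unit
  have hCu : IsUnit (C α₀) := by
    simp only [hC]
    rw [Nat.cast_prod]
    refine IsUnit.prod_iff.mpr fun j _ => ?_
    rw [Finsupp.smul_apply, smul_eq_mul, hql, hwp]
    by_cases hji : j = i
    · subst hji
      rw [hα₀i', Nat.choose_succ_self_right]
      exact isUnit_natCast_of_not_dvd _ (hα₀i' ▸ hi)
    · rw [hα₀j j hji, Nat.choose_self, Nat.cast_one]
      exact isUnit_one
  have hcC : Q.coeff α₀ * C α₀ ∈ maximalIdeal R := by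
    have := sub_mem hy hsum
    rwa [sub_sub_cancel] at this
  rcases (Ideal.IsMaximal.isPrime' (maximalIdeal R)).mem_or_mem hcC with h | h
  · exact hc h
  · exact (maximalIdeal.isMaximal R).ne_top (Ideal.eq_top_of_isUnit_mem _ h hCu)

end CompanionAlgebra

end Summit.ResolutionOfSingularities.ResolutionOfSingularities.Theorems.HugValuationCut
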